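import Literature.NumberTheory.LFunctions.WeilFirstPrimeCertificateDataC
import HarnessLib

/-!
# First-prime Weil positivity, stage C: kernel check of the even scaled moments ν_108, ν_110, ν_112, ν_114, ν_116, ν_118

Part of `weilCert3C.check` (`WeilFirstPrimeCertificateDataC.lean`), evaluated by `decide +kernel` and kept in its own
file for kernel time and memory (each declaration is checked separately). Assembled in
`WeilFirstPrimeCertificateCCheck.lean`. Pure proof file; nothing is asserted.
-/

noncomputable section

namespace Literature.NumberTheory.LFunctions

set_option maxHeartbeats 0 in
/-- **Kernel check of the scaled moment `ν_{108}`** of the stage-C first-prime certificate. [folklore] -/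
theorem checkNuAt108_weilCert3C : weilCert3C.checkNuAt 108 = true := by
  decide +kernel

set_option maxHeartbeats 0 in
/-- **Kernel check of the scaled moment `ν_{110}`** of the stage-C first-prime certificate. [folklore] -/
theorem checkNuAt110_weilCert3C : weilCert3C.checkNuAt 110 = true := by
  decide +kernel

set_option maxHeartbeats 0 in
/-- **Kernel check of the scaled moment `ν_{112}`** of the stage-C first-prime certificate. [folklore] -/
theorem checkNuAt112_weilCert3C : weilCert3C.checkNuAt 112 = true := by
  decide +kernel

set_option maxHeartbeats 0 in
/-- **Kernel check of the scaled moment `ν_{114}`** of the stage-C first-prime certificate. [folklore] -/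
theorem checkNuAt114_weilCert3C : weilCert3C.checkNuAt 114 = true := by
  decide +kernel

set_option maxHeartbeats 0 in
/-- **Kernel check of the scaled moment `ν_{116}`** of the stage-C first-prime certificate. [folklore] -/
theorem checkNuAt116_weilCert3C : weilCert3C.checkNuAt 116 = true := by
  decide +kernel

set_option maxHeartbeats 0 in
/-- **Kernel check of the scaled moment `ν_{118}`** of the stage-C first-prime certificate. [folklore] -/
theorem checkNuAt118_weilCert3C : weilCert3C.checkNuAt 118 = true := by
  decide +kernel

end Literature.NumberTheory.LFunctions
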